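import Mathlib
import HarnessLib
import Summits.ResolutionOfSingularities.ResolutionOfSingularities.Theorems.WildQuotientsWildQuotientResolutionS1aCentreAway
import Summits.ResolutionOfSingularities.ResolutionOfSingularities.Theorems.WildQuotientsWildQuotientResolutionS1aFiltrationAgree
import Summits.ResolutionOfSingularities.ResolutionOfSingularities.Theorems.WildQuotientsWildQuotientResolutionS1aBlowupNodeAtlas

/-!
# S1a — K-LOC (α1): the degree-0 TRACE of a weighted filtration with degree-0 associates of the generators, and the SECTION FORM of a chart filtration

[OURS · L1 W4.5c · lead-1 g16; plan-1 RULINGS R-F15o/R-F15p — brick for the overlap agreement (`hagree` of ✓`exists_isPrincipalCentre_of_agree_filtration_eq`)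
of the glued level-2 centre `S′` of R4e: on the producer chart `O′ᵢ₁` the member generators `X′₀, φᵢ` have the DEGREE-0 associates `X′₀·X′₁^{-w₀} = x₀/(x₁−αᵢ)^{w₀}`
and `φᵢ·X′₁^{-sh} = t/(x₁−αᵢ)^{sh}` (`X′₁` is a homogeneous unit there), so the chart filtration is the weighted filtration of honest SECTIONS, whose restrictions
to an overlap differ from the neighbouring chart's by units] — NOT statements of the manuscript; counted 0; AI-level work, weaker than expert review. Crux
stmt-ResolutionOfSingularities-17941 `CyclicQuotientFourfolds`, line `s1a-logminvertex` v13 (`stub_reachLowerInFX`).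

* `CoarseChart.mem_of_coe_mem_map` — `I₀ ≤ 𝒜 0` an ideal of the degree-0 ring: `↑x ∈ I₀·B ⇒ x ∈ I₀` (degree-0 projection);
* ★ `CoarseChart.traceFiltration_eq_of_associated` — if each `f i` is associated to a degree-0 element `f₀ i`, then `trace 𝒥ₙ(f; w) = 𝒥ₙ(f₀; w)` in `𝒜 0`;
* `CoarseChart.weightedFiltration_eq_of_associated` — associated generators give the same weighted filtration;
* ★ `CoarseChart.filtration_eq_weightedFiltration_sections` — a chart filtration given by the restriction/trace formula is, on every affine `U ≤ W`, the weighted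
  filtration of the restricted SECTIONS `a i` whenever `eL (a i)` is associated to `f i`.
-/

set_option linter.dupNamespace false

noncomputable section

open CategoryTheory Limits AlgebraicGeometry TopologicalSpace Opposite
open Literature.AlgebraicGeometry.Resolution
open DirectSum
open Summit.ResolutionOfSingularities.ResolutionOfSingularities.Theorems.WildQuotientResolution.S1
open Summit.ResolutionOfSingularities.ResolutionOfSingularities.Theorems.WildQuotientResolution.S1.BlowupCharts

namespace Summit.ResolutionOfSingularities.ResolutionOfSingularities.Theorems.WildQuotientResolution.S1.CoarseChart

variable {ι : Type} [AddCommGroup ι] [DecidableEq ι] {B : Type} [CommRing B] (𝒜 : ι → AddSubgroup B) [GradedRing 𝒜]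

/-- **Degree-0 projection**: for an ideal `I₀` of the degree-0 ring, `↑x ∈ I₀·B` implies `x ∈ I₀`. [folklore] -/
theorem mem_of_coe_mem_map (I₀ : Ideal ↥(𝒜 0)) (x : ↥(𝒜 0)) (hx : (x : B) ∈ I₀.map (algebraMap ↥(𝒜 0) B)) : x ∈ I₀ := by
  classical
  -- predicate: every degree-0 component of every multiple lies in the image of `I₀`
  have key : ∀ y ∈ I₀.map (algebraMap ↥(𝒜 0) B), ∀ r : B, ∃ a ∈ I₀, (decompose 𝒜 (r * y) 0 : B) = (a : B) := by
    intro y hy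
    refine Submodule.span_induction ?_ ?_ ?_ ?_ hy
    · rintro _ ⟨a, ha, rfl⟩ r
      refine ⟨⟨(decompose 𝒜 r 0 : B), (decompose 𝒜 r 0).2⟩ * a, I₀.mul_mem_left _ ha, ?_⟩
      change (decompose 𝒜 (r * (a : B)) 0 : B) = (decompose 𝒜 r 0 : B) * (a : B)
      exact coe_decompose_mul_of_right_mem_zero 𝒜 a.2
    · intro r
      exact ⟨0, I₀.zero_mem, by rw [mul_zero, decompose_zero]; rfl⟩
    · intro y z _ _ hy hz r
      obtain ⟨a, ha, hya⟩ := hy r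
      obtain ⟨b, hb, hzb⟩ := hz r
      refine ⟨a + b, I₀.add_mem ha hb, ?_⟩
      rw [mul_add, decompose_add, DirectSum.add_apply, AddSubgroup.coe_add, hya, hzb]
      rfl
    · intro c y _ hy r
      obtain ⟨a, ha, hya⟩ := hy (r * c)
      exact ⟨a, ha, by rw [smul_eq_mul, ← mul_assoc]; exact hya⟩
  obtain ⟨a, ha, hxa⟩ := key (x : B) hx 1
  rw [one_mul, decompose_of_mem_same 𝒜 x.2] at hxa
  have : x = a := Subtype.ext hxa
  rw [this]
  exact ha

/-- Associated generators give the same weighted filtration. [folklore] -/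
theorem weightedFiltration_eq_of_associated {c : ℕ} (f g : Fin c → B) (w : Fin c → ℕ) (h : ∀ i, Associated (f i) (g i)) (n : ℕ) :
    (weightedFiltration f w).ideal n = (weightedFiltration g w).ideal n := by
  refine KillCert.weightedFiltration_eq_of_mem_of_mem f w g w (fun i => ?_) (fun i => ?_) n
  · obtain ⟨u, hu⟩ := h i
    rw [← hu]
    exact Ideal.mul_mem_right _ _ (mem_weightedFiltration_ideal f w i)
  · obtain ⟨u, hu⟩ := (h i).symm
    rw [← hu]
    exact Ideal.mul_mem_right _ _ (mem_weightedFiltration_ideal g w i)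

/-- ★ **The degree-0 trace of `𝒥(f; w)` is the weighted filtration of degree-0 associates** `f₀` of the generators. [OURS · L1 W4.5c; folklore] -/
theorem traceFiltration_eq_of_associated {c : ℕ} (f : Fin c → B) (w : Fin c → ℕ) (f₀ : Fin c → ↥(𝒜 0)) (hf : ∀ i, Associated (f i) ((f₀ i : ↥(𝒜 0)) : B))
    (n : ℕ) : (traceFiltration 𝒜 f w).ideal n = (weightedFiltration f₀ w).ideal n := by
  have h1 : (weightedFiltration f w).ideal n = (weightedFiltration (fun i => ((f₀ i : ↥(𝒜 0)) : B)) w).ideal n :=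
    weightedFiltration_eq_of_associated f _ w hf n
  have h2 : (weightedFiltration (fun i => ((f₀ i : ↥(𝒜 0)) : B)) w).ideal n = ((weightedFiltration f₀ w).ideal n).map (algebraMap ↥(𝒜 0) B) := by
    rw [CentreAway.map_weightedFiltration_ideal]; rfl
  ext x
  rw [mem_traceFiltration_iff, h1, h2]
  exact ⟨mem_of_coe_mem_map 𝒜 _ x, fun hx => Ideal.mem_map_of_mem _ hx⟩

/-- ★ **SECTION FORM OF A CHART FILTRATION**: if `𝒦₀` restricts on every affine `U ≤ W` to the extension of `eL⁻¹(trace 𝒥ₙ(f; w))` and each `eL (a i)` is associated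
to `f i`, then `(𝒦₀|U)_n = 𝒥ₙ(a|U; w)`. [OURS · L1 W4.5c] -/
theorem filtration_eq_weightedFiltration_sections {V : Scheme.{0}} (𝒦₀ : ReesFiltration V) (W : V.Opens)
    {P : Type} [CommRing P] (𝒢 : ι → AddSubgroup P) [GradedRing 𝒢] (eL : Γ(V, W) ≃+* ↥(𝒢 0))
    {c : ℕ} (f : Fin c → P) (w : Fin c → ℕ)
    (hres : ∀ (U : V.affineOpens) (hU : U.1 ≤ W) (n : ℕ), (𝒦₀.filtration U).ideal n =
      ((((traceFiltration 𝒢 f w).ideal n).comap (eL : Γ(V, W) →+* ↥(𝒢 0))).map (V.presheaf.map (homOfLE hU).op).hom))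
    (a : Fin c → Γ(V, W)) (ha : ∀ i, Associated (f i) ((eL (a i) : ↥(𝒢 0)) : P))
    (U : V.affineOpens) (hU : U.1 ≤ W) (n : ℕ) :
    (𝒦₀.filtration U).ideal n = (weightedFiltration (fun i => (V.presheaf.map (homOfLE hU).op).hom (a i)) w).ideal n := by
  rw [hres U hU n, traceFiltration_eq_of_associated 𝒢 f w (fun i => eL (a i)) ha n]
  have hfun : (fun i => eL (a i)) = ((eL : Γ(V, W) →+* ↥(𝒢 0)) : Γ(V, W) → ↥(𝒢 0)) ∘ a := rfl
  have hc : ((weightedFiltration (fun i => eL (a i)) w).ideal n).comap (eL : Γ(V, W) →+* ↥(𝒢 0)) = (weightedFiltration a w).ideal n := by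
    rw [hfun, ← CentreAway.map_weightedFiltration_ideal]
    exact Ideal.comap_map_of_bijective _ eL.bijective
  rw [hc, CentreAway.map_weightedFiltration_ideal]
  rfl

end Summit.ResolutionOfSingularities.ResolutionOfSingularities.Theorems.WildQuotientResolution.S1.CoarseChart

end
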